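import Summits.AtomisticToContinuum.BoseEinsteinCondensation.Theorems.BECCutLineWeakDisorderWitnessTransferFormBoundPotential
import Literature.MathematicalPhysics.QuantumManyBody.GroundStateFeynmanKacFormUpper
import Literature.MathematicalPhysics.QuantumManyBody.GroundStateFeynmanKacInteraction
import HarnessLib

/-!
# Route BECCutLineWeakDisorder — `WitnessTransfer`, form bound III: stub `stub_formBound` (E1a)

Support file (does not close the item) for item stmt-AtomisticToContinuum-14978
(`Summit.AtomisticToContinuum.BoseEinsteinCondensation.Theses.BECCutLineWeakDisorder`, decl
`WitnessTransfer`), line `Sketch`: the registered stub `stub_formBound`. For a general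
measurable pair potential `v : ℝ → [0, ∞]` (hard cores allowed), `L > 0`, and a measurable
bounded `Ψ ≥ 0` vanishing off `Λ_L^N` with `∫Ψ² = 1` and the integrated eigen-inequality
`e^{−Et} ≤ ⟨Ψ, e^{−tH}Ψ⟩` (`t > 0`):

* the potential energy is finite and `∫ V Ψ² ≤ E`;
* for every `ε > 0`, eventually as `t → 0+`: `sqIncr_t Ψ / (2t) ≤ E − ∫VΨ² + ε`.

This is Part II of `GroundStateFeynmanKacProofs` (`eigen_pairing_upper_bound`,
`sqIncr_div_eventually_le`) with BOTH restrictions removed: boundedness of `v` (the potential is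
truncated to `min v k` INSIDE the weight defect, `interactionTerm_le_defect_add_sq`, and
`∫(V∧k)Ψ² ↑ ∫VΨ²` by monotone convergence) and continuity of `Ψ` (the `L¹`-translation errors of
the slice comparison are paid by `sqIncr_s Ψ ≤ 2(1 − e^{−Es})`, `translate_errors_le_three_mul`).

* `sqIncr_div_le_explicit`, `exists_sqIncr_div_le` — the master inequality
  `sqIncr_t Ψ/(2t) ≤ E − ∫V'Ψ² + K((1 + η)t + η⁻¹)` for every bounded `V' = ∑ v'`, `v' ≤ v`,
  every `η > 0` and `t > 0`;
* `lintegral_interaction_mul_le_of_eig` — `∫ V'Ψ² ≤ E` (`t → 0+`, then `η → ∞`);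
* `stub_formBound` — the registered statement.

## References

* K. L. Chung, Z. Zhao, *From Brownian Motion to Schrödinger's Equation* (1995), Thm 3.27,
  Prop 3.29 (81). [ChungZhao1995]
-/

noncomputable section

open MeasureTheory Filter Set Metric
open scoped ENNReal NNReal Topology

namespace Summit.AtomisticToContinuum.BoseEinsteinCondensation.Theorems.CutLineWitness

open Literature.MathematicalPhysics.QuantumManyBody.BoseGas

variable {N : ℕ}

section Core

variable {L : ℝ} {v v' : ℝ → ℝ≥0∞} {C : ℝ≥0} {Ψ : Config N → ℝ} {M E : ℝ}

/-- **The master inequality of a rough witness, explicit constants.** For a bounded `v' ≤ v`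
(`v' ≤ C`), `η > 0` and `t > 0`:
`sqIncr_t Ψ/(2t) ≤ E − ∫V'Ψ² + (N²C)²M²|Λ| t + 3N²CM (2ηEt + 2|Λ|/η)`
(energy inequality `sqIncr/2 + D ≤ 1 − e^{−Et} ≤ Et`, truncation `t∫V'Ψ² ≤ J' + …`,
`J' ≤ D + Q'`, `Q' = O(t²)`). [cite: ChungZhao1995, Prop 3.29 (81)] -/
theorem sqIncr_div_le_explicit (hv : Measurable v) (hΨm : Measurable Ψ) (hM : ∀ X, |Ψ X| ≤ M)
    (hnn : ∀ X, 0 ≤ Ψ X) (h0 : ∀ X, X ∉ boxN N L → Ψ X = 0) (hnorm : ∫ X, Ψ X ^ 2 = 1)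
    (heig : ∀ t : ℝ, 0 < t → Real.exp (-(E * t)) ≤ ∫ X, Ψ X * fkReal v L t Ψ X)
    (hv' : Measurable v') (hC : ∀ r, v' r ≤ C) (hle : ∀ r, v' r ≤ v r) {η : ℝ} (hη : 0 < η)
    {t : ℝ≥0} (ht : 0 < t) :
    (sqIncr t Ψ).toReal / (2 * t) ≤ E - (∫⁻ x, interaction v' x * ‖Ψ x‖ₑ ^ 2).toReal +
      ((((N * N : ℕ) : ℝ) * C) ^ 2 * M * (M * (volume (boxN N L)).toReal)) * t +
      3 * (((N * N : ℕ) : ℝ) * C * M) * (2 * η * E * t + 2 * (volume (boxN N L)).toReal / η) := by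
  set V : ℝ≥0∞ := volume (boxN N L) with hVdef
  have hV : V ≠ ⊤ := (volume_boxN_lt_top N L).ne
  have hM0 : 0 ≤ M := (abs_nonneg _).trans (hM 0)
  have hE := nonneg_of_eig hv hΨm hM hnn h0 hnorm heig
  have ht' : (0 : ℝ) < t := ht
  set cV : ℝ≥0∞ := (N * N : ℕ) * C with hcVdef
  have hcV : cV ≠ ⊤ := ENNReal.mul_ne_top (ENNReal.natCast_ne_top _) ENNReal.coe_ne_top
  set g : ℝ := 2 * η * E * t + 2 * V.toReal / η with hgdef
  have hg0 : 0 ≤ g := by positivity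
  set I' : ℝ≥0∞ := ∫⁻ x, interaction v' x * ‖Ψ x‖ₑ ^ 2 with hI'def
  set D : ℝ≥0∞ := ∫⁻ x, ‖Ψ x‖ₑ * ∫⁻ ω, (1 - fkWeight v L t x ω) * ‖Ψ (x + displacement t ω)‖ₑ
    ∂wienerPaths N with hDdef
  set J : ℝ≥0∞ := ∫⁻ x, ‖Ψ x‖ₑ * ∫⁻ ω, pathAction v' t x ω * ‖Ψ (worldLine x ω t)‖ₑ
    ∂wienerPaths N with hJdef
  set Q : ℝ≥0∞ := ∫⁻ x, ‖Ψ x‖ₑ * ∫⁻ ω, pathAction v' t x ω ^ 2 * ‖Ψ (x + displacement t ω)‖ₑ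
    ∂wienerPaths N with hQdef
  set S : ℝ≥0∞ := ENNReal.ofReal (2 * (1 - Real.exp (-(E * t)))) with hSdef
  set G : ℝ≥0∞ := ENNReal.ofReal η * S + (ENNReal.ofReal η)⁻¹ * (2 * V) with hGdef
  set A : ℝ≥0∞ := cV * ENNReal.ofReal M with hAdef
  set Bq : ℝ≥0∞ := (cV * ENNReal.ofReal t) ^ 2 * ENNReal.ofReal M * (ENNReal.ofReal M * V)
    with hBqdef
  -- the `[0, ∞]` inequalities
  have hsq : ∀ s : ℝ≥0, s ≤ t → sqIncr s Ψ ≤ S := by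
    intro s hs
    rcases eq_or_ne s 0 with h | h
    · rw [h, sqIncr_zero]; exact bot_le
    · exact sqIncr_le_of_eig hv hΨm hM hnn h0 hnorm heig (pos_iff_ne_zero.2 h) hs
  have h1 : I' * t ≤ J + A * (3 * G) * t :=
    lintegral_interaction_mul_le_interactionTerm_add hv' hC hΨm hM h0 hsq hη
  have h2 : J ≤ D + Q := interactionTerm_le_defect_add_sq hv hC hle L t hΨm
  have h3 : Q ≤ Bq := (lintegral_pathAction_sq_le hC t hM).trans
    (mul_le_mul' le_rfl (lintegral_enorm_le_of_box hM h0))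
  have h1exp : 1 - Real.exp (-(E * t)) ≤ E * t := by linarith [Real.add_one_le_exp (-(E * t))]
  have hGle : G ≤ ENNReal.ofReal g := by
    have hS' : S ≤ ENNReal.ofReal (2 * (E * t)) := ENNReal.ofReal_le_ofReal (by linarith)
    calc G ≤ ENNReal.ofReal η * ENNReal.ofReal (2 * (E * t)) + (ENNReal.ofReal η)⁻¹ * (2 * V) := by
          rw [hGdef]; gcongr
      _ = ENNReal.ofReal g := by
          rw [← ENNReal.ofReal_inv_of_pos hη, ← ENNReal.ofReal_toReal hV, ← ENNReal.ofReal_ofNat 2,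
            ← ENNReal.ofReal_mul zero_le_two, ← ENNReal.ofReal_mul (inv_nonneg.2 hη.le),
            ← ENNReal.ofReal_mul hη.le, ← ENNReal.ofReal_add (by positivity) (by positivity), hgdef]
          congr 1
          field_simp
  have h5 : I' * t ≤ D + Bq + A * (3 * ENNReal.ofReal g) * t :=
    h1.trans (add_le_add (h2.trans (add_le_add le_rfl h3))
      (mul_le_mul' (mul_le_mul' le_rfl (mul_le_mul' le_rfl hGle)) le_rfl))
  -- finiteness
  have hD : D ≠ ⊤ := fkDefect_ne_top_of_box v L t hM h0
  have hBq : Bq ≠ ⊤ := ENNReal.mul_ne_top (ENNReal.mul_ne_top (ENNReal.pow_ne_top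
    (ENNReal.mul_ne_top hcV ENNReal.ofReal_ne_top)) ENNReal.ofReal_ne_top)
    (ENNReal.mul_ne_top ENNReal.ofReal_ne_top hV)
  have hA : A ≠ ⊤ := ENNReal.mul_ne_top hcV ENNReal.ofReal_ne_top
  have hA3 : A * (3 * ENNReal.ofReal g) * t ≠ ⊤ := ENNReal.mul_ne_top (ENNReal.mul_ne_top hA
    (ENNReal.mul_ne_top ENNReal.ofNat_ne_top ENNReal.ofReal_ne_top)) ENNReal.coe_ne_top
  have hsq1 : ∫⁻ X, ENNReal.ofReal (Ψ X ^ 2) = 1 :=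
    lintegral_ofReal_sq_eq_one_of_box hΨm hM h0 hnorm
  have hI' : I' ≠ ⊤ := ne_top_of_le_ne_top
    (ENNReal.mul_ne_top hcV (by rw [hsq1]; exact ENNReal.one_ne_top))
    (lintegral_interaction_mul_le_of_le hC Ψ)
  -- to reals
  have h6 := ENNReal.toReal_mono (ENNReal.add_ne_top.2 ⟨ENNReal.add_ne_top.2 ⟨hD, hBq⟩, hA3⟩) h5
  rw [ENNReal.toReal_mul, ENNReal.coe_toReal,
    ENNReal.toReal_add (ENNReal.add_ne_top.2 ⟨hD, hBq⟩) hA3, ENNReal.toReal_add hD hBq] at h6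
  have hBqr : Bq.toReal = ((((N * N : ℕ) : ℝ) * C) * t) ^ 2 * M * (M * V.toReal) := by
    rw [hBqdef, hcVdef]
    simp only [ENNReal.toReal_mul, ENNReal.toReal_pow, ENNReal.toReal_ofReal hM0,
      ENNReal.toReal_ofReal ht'.le, ENNReal.toReal_natCast, ENNReal.coe_toReal]
  have hA3r : (A * (3 * ENNReal.ofReal g) * t).toReal =
      (((N * N : ℕ) : ℝ) * C) * M * (3 * g) * t := by
    rw [hAdef, hcVdef]
    simp only [ENNReal.toReal_mul, ENNReal.toReal_ofReal hM0, ENNReal.toReal_ofReal hg0,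
      ENNReal.toReal_ofNat, ENNReal.toReal_natCast, ENNReal.coe_toReal]
  rw [hBqr, hA3r] at h6
  have h4 := sqIncr_half_add_defect_le hv hΨm hM hnn h0 hnorm heig ht
  -- assemble in `ℝ`
  rw [div_le_iff₀ (by positivity : (0 : ℝ) < 2 * t)]
  have hfin : (sqIncr t Ψ).toReal ≤ 2 * (E * t - I'.toReal * t +
      (((N * N : ℕ) : ℝ) * C * t) ^ 2 * M * (M * V.toReal) +
        ((N * N : ℕ) : ℝ) * C * M * (3 * g) * t) := by
    linarith
  refine hfin.trans (le_of_eq ?_)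
  rw [hgdef]
  ring

/-- **The master inequality of a rough witness**: for a bounded `v' ≤ v` there is `K ≥ 0` with
`sqIncr_t Ψ/(2t) ≤ E − ∫V'Ψ² + K((1 + η)t + η⁻¹)` for all `η > 0`, `t > 0`.
[cite: ChungZhao1995, Prop 3.29 (81)] -/
theorem exists_sqIncr_div_le (hv : Measurable v) (hΨm : Measurable Ψ) (hM : ∀ X, |Ψ X| ≤ M)
    (hnn : ∀ X, 0 ≤ Ψ X) (h0 : ∀ X, X ∉ boxN N L → Ψ X = 0) (hnorm : ∫ X, Ψ X ^ 2 = 1)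
    (heig : ∀ t : ℝ, 0 < t → Real.exp (-(E * t)) ≤ ∫ X, Ψ X * fkReal v L t Ψ X)
    (hv' : Measurable v') (hC : ∀ r, v' r ≤ C) (hle : ∀ r, v' r ≤ v r) :
    ∃ K : ℝ, 0 ≤ K ∧ ∀ η : ℝ, 0 < η → ∀ t : ℝ≥0, 0 < t →
      (sqIncr t Ψ).toReal / (2 * t) ≤ E - (∫⁻ x, interaction v' x * ‖Ψ x‖ₑ ^ 2).toReal +
        K * ((1 + η) * t + η⁻¹) := by
  have hM0 : 0 ≤ M := (abs_nonneg _).trans (hM 0)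
  have hE := nonneg_of_eig hv hΨm hM hnn h0 hnorm heig
  set a : ℝ := ((N * N : ℕ) : ℝ) * C * M with ha
  set Vr : ℝ := (volume (boxN N L)).toReal with hVr
  set q : ℝ := (((N * N : ℕ) : ℝ) * C) ^ 2 * M * (M * Vr) with hq
  have ha0 : 0 ≤ a := by positivity
  have hVr0 : 0 ≤ Vr := ENNReal.toReal_nonneg
  have hq0 : 0 ≤ q := by positivity
  refine ⟨q + 6 * a * E + 6 * a * Vr, by positivity, fun η hη t ht => ?_⟩
  have h := sqIncr_div_le_explicit hv hΨm hM hnn h0 hnorm heig hv' hC hle hη ht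
  have ht0 : (0 : ℝ) ≤ t := t.coe_nonneg
  have hη0 : 0 ≤ η⁻¹ := inv_nonneg.2 hη.le
  have e1 : q * t ≤ (q + 6 * a * E + 6 * a * Vr) * t :=
    mul_le_mul_of_nonneg_right (by nlinarith) ht0
  have e2 : 6 * a * E * (η * t) ≤ (q + 6 * a * E + 6 * a * Vr) * (η * t) :=
    mul_le_mul_of_nonneg_right (by nlinarith) (by positivity)
  have e3 : 6 * a * Vr * η⁻¹ ≤ (q + 6 * a * E + 6 * a * Vr) * η⁻¹ :=
    mul_le_mul_of_nonneg_right (by nlinarith) hη0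
  have hexp : 3 * a * (2 * η * E * t + 2 * Vr / η) = 6 * a * E * (η * t) + 6 * a * Vr * η⁻¹ := by
    ring
  rw [← ha, ← hq, hexp] at h
  calc (sqIncr t Ψ).toReal / (2 * t) ≤ _ := h
    _ ≤ _ := by nlinarith [e1, e2, e3]

/-- **The truncated potential energy of a rough witness is at most `E`**: `∫ V'Ψ² ≤ E` for every
bounded `v' ≤ v` (the master inequality with `sqIncr ≥ 0`, `t → 0+`, then `η → ∞`). [folklore] -/
theorem lintegral_interaction_mul_le_of_eig (hv : Measurable v) (hΨm : Measurable Ψ)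
    (hM : ∀ X, |Ψ X| ≤ M) (hnn : ∀ X, 0 ≤ Ψ X) (h0 : ∀ X, X ∉ boxN N L → Ψ X = 0)
    (hnorm : ∫ X, Ψ X ^ 2 = 1)
    (heig : ∀ t : ℝ, 0 < t → Real.exp (-(E * t)) ≤ ∫ X, Ψ X * fkReal v L t Ψ X)
    (hv' : Measurable v') (hC : ∀ r, v' r ≤ C) (hle : ∀ r, v' r ≤ v r) :
    ∫⁻ x, interaction v' x * ‖Ψ x‖ₑ ^ 2 ≤ ENNReal.ofReal E := by
  obtain ⟨K, -, hK⟩ := exists_sqIncr_div_le hv hΨm hM hnn h0 hnorm heig hv' hC hle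
  set I' : ℝ≥0∞ := ∫⁻ x, interaction v' x * ‖Ψ x‖ₑ ^ 2 with hI'def
  have hsq1 : ∫⁻ X, ENNReal.ofReal (Ψ X ^ 2) = 1 :=
    lintegral_ofReal_sq_eq_one_of_box hΨm hM h0 hnorm
  have hI' : I' ≠ ⊤ := ne_top_of_le_ne_top (ENNReal.mul_ne_top (ENNReal.mul_ne_top
    (ENNReal.natCast_ne_top _) ENNReal.coe_ne_top) (by rw [hsq1]; exact ENNReal.one_ne_top))
    (lintegral_interaction_mul_le_of_le hC Ψ)
  have h1 : ∀ η : ℝ, 0 < η → I'.toReal ≤ E + K * η⁻¹ := by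
    intro η hη
    have hlim : Tendsto (fun t : ℝ≥0 => E + K * ((1 + η) * (t : ℝ) + η⁻¹)) (𝓝[>] 0)
        (𝓝 (E + K * η⁻¹)) := by
      have hc : Continuous fun t : ℝ≥0 => E + K * ((1 + η) * (t : ℝ) + η⁻¹) :=
        continuous_const.add (continuous_const.mul ((continuous_const.mul NNReal.continuous_coe).add
          continuous_const))
      have h := hc.tendsto 0
      simp only [NNReal.coe_zero, mul_zero, zero_add] at h
      exact h.mono_left nhdsWithin_le_nhds
    refine ge_of_tendsto hlim ?_
    filter_upwards [self_mem_nhdsWithin] with t ht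
    have h := hK η hη t ht
    have ht' : (0 : ℝ) < t := ht
    have h0' : 0 ≤ (sqIncr t Ψ).toReal / (2 * t) := by positivity
    linarith
  have h2 : I'.toReal ≤ E := by
    have hlim : Tendsto (fun η : ℝ => E + K * η⁻¹) atTop (𝓝 (E + K * 0)) :=
      tendsto_const_nhds.add (tendsto_const_nhds.mul tendsto_inv_atTop_zero)
    rw [mul_zero, add_zero] at hlim
    exact ge_of_tendsto hlim ((eventually_gt_atTop 0).mono fun η hη => h1 η hη)
  rw [← ENNReal.ofReal_toReal hI']
  exact ENNReal.ofReal_le_ofReal h2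

end Core

/-- **(E1a) Form bound from the integrated eigen-inequality.** For measurable `v : ℝ → [0,∞]`,
`L > 0`, and a measurable bounded `Ψ ≥ 0` vanishing off `Λ_L^N` with `∫Ψ² = 1` and
`e^{-Et} ≤ ⟨Ψ, e^{-tH}Ψ⟩` for all `t > 0`: the potential energy is finite, `∫ V Ψ² ≤ E`, and
`limsup_{t→0+} sqIncr_t Ψ/(2t) ≤ E − ∫VΨ²` (square identity, `1 − w_t ≥ 1 − e^{-∫₀ᵗ(V∧k)}`,
monotone convergence in `k`; the `L²`-continuity of the free flow on `Ψ` comes from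
`sqIncr_t Ψ ≤ 2(1 − e^{-Et})`). [cite: ChungZhao1995, Prop 3.29] -/
theorem stub_formBound {N : ℕ} {v : ℝ → ℝ≥0∞} (hv : Measurable v) {L : ℝ} (hL : 0 < L)
    {Ψ : Config N → ℝ} (hΨm : Measurable Ψ) {M : ℝ} (hM : ∀ X, |Ψ X| ≤ M) (hnn : ∀ X, 0 ≤ Ψ X)
    (h0 : ∀ X, X ∉ boxN N L → Ψ X = 0) (hnorm : ∫ X, Ψ X ^ 2 = 1) {E : ℝ}
    (heig : ∀ t : ℝ, 0 < t → Real.exp (-(E * t)) ≤ ∫ X, Ψ X * fkReal v L t Ψ X) :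
    (∫⁻ X, ENNReal.ofReal (Ψ X ^ 2) * interaction v X) ≤ ENNReal.ofReal E ∧
    ∀ ε : ℝ, 0 < ε → ∀ᶠ t : ℝ≥0 in 𝓝[>] 0, (ENNReal.ofReal (2 * t))⁻¹ * sqIncr t Ψ ≤
      ENNReal.ofReal (E - (∫⁻ X, ENNReal.ofReal (Ψ X ^ 2) * interaction v X).toReal + ε) := by
  have _hL := hL
  -- the truncations `min v k`
  set vk : ℕ → ℝ → ℝ≥0∞ := fun k r => min (v r) k with hvkdef
  have hvk : ∀ k, Measurable (vk k) := fun k => hv.min measurable_const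
  have hCk : ∀ (k : ℕ) (r : ℝ), vk k r ≤ ((k : ℝ≥0) : ℝ≥0∞) := fun k r =>
    (min_le_right _ _).trans_eq (ENNReal.coe_natCast k).symm
  have hlek : ∀ (k : ℕ) (r : ℝ), vk k r ≤ v r := fun k r => min_le_left _ _
  have hIk : ∀ k : ℕ, ∫⁻ x, interaction (vk k) x * ‖Ψ x‖ₑ ^ 2 ≤ ENNReal.ofReal E := fun k =>
    lintegral_interaction_mul_le_of_eig hv hΨm hM hnn h0 hnorm heig (hvk k) (hCk k) (hlek k)
  have htend := tendsto_lintegral_interaction_min (N := N) hv hΨm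
  have hI : ∫⁻ x, interaction v x * ‖Ψ x‖ₑ ^ 2 ≤ ENNReal.ofReal E := le_of_tendsto' htend hIk
  rw [← lintegral_interaction_mul_enorm_sq]
  refine ⟨hI, fun ε hε => ?_⟩
  set I : ℝ≥0∞ := ∫⁻ x, interaction v x * ‖Ψ x‖ₑ ^ 2 with hIdef
  have hItop : I ≠ ⊤ := ne_top_of_le_ne_top ENNReal.ofReal_ne_top hI
  -- choose the truncation level `k`
  have hk := ((ENNReal.tendsto_toReal hItop).comp htend).eventually
    (lt_mem_nhds (by linarith : I.toReal - ε / 3 < I.toReal))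
  obtain ⟨k, hk⟩ := hk.exists
  -- the master inequality for `min v k`
  obtain ⟨K, hK0, hK⟩ := exists_sqIncr_div_le hv hΨm hM hnn h0 hnorm heig (hvk k) (hCk k) (hlek k)
  -- choose `η`
  obtain ⟨η, hη, hKη⟩ : ∃ η : ℝ, 0 < η ∧ K * η⁻¹ < ε / 3 := by
    have hlim : Tendsto (fun η : ℝ => K * η⁻¹) atTop (𝓝 (K * 0)) :=
      tendsto_const_nhds.mul tendsto_inv_atTop_zero
    rw [mul_zero] at hlim
    obtain ⟨η, h1, h2⟩ := ((eventually_gt_atTop 0).and (hlim.eventually (gt_mem_nhds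
      (by positivity : (0 : ℝ) < ε / 3)))).exists
    exact ⟨η, h1, h2⟩
  -- small `t`
  have hlimt : Tendsto (fun t : ℝ≥0 => K * ((1 + η) * (t : ℝ))) (𝓝[>] 0) (𝓝 0) := by
    have hc : Continuous fun t : ℝ≥0 => K * ((1 + η) * (t : ℝ)) :=
      continuous_const.mul (continuous_const.mul NNReal.continuous_coe)
    have h := hc.tendsto 0
    simp only [NNReal.coe_zero, mul_zero] at h
    exact h.mono_left nhdsWithin_le_nhds
  have hsq1 : ∫⁻ X, ENNReal.ofReal (Ψ X ^ 2) = 1 :=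
    lintegral_ofReal_sq_eq_one_of_box hΨm hM h0 hnorm
  filter_upwards [hlimt.eventually (gt_mem_nhds (by positivity : (0 : ℝ) < ε / 3)),
    self_mem_nhdsWithin] with t ht htpos
  have ht' : (0 : ℝ) < t := htpos
  have hcore := hK η hη t htpos
  have hreal : (sqIncr t Ψ).toReal / (2 * t) ≤ E - I.toReal + ε := by
    have hsplit : K * ((1 + η) * t + η⁻¹) = K * ((1 + η) * t) + K * η⁻¹ := by ring
    have hk' : I.toReal - ε / 3 < (∫⁻ x, interaction (vk k) x * ‖Ψ x‖ₑ ^ 2).toReal := hk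
    linarith
  -- back to `[0, ∞]`
  have hsq_top : sqIncr t Ψ ≠ ⊤ := (sqIncr_lt_top hΨm (by rw [hsq1]; exact ENNReal.one_ne_top) t).ne
  have hX : (ENNReal.ofReal (2 * t))⁻¹ * sqIncr t Ψ =
      ENNReal.ofReal ((sqIncr t Ψ).toReal / (2 * t)) := by
    rw [ENNReal.ofReal_div_of_pos (by positivity), ENNReal.ofReal_toReal hsq_top,
      ENNReal.div_eq_inv_mul, ENNReal.ofReal_mul zero_le_two, ENNReal.ofReal_ofNat,
      ENNReal.ofReal_coe_nnreal]
  rw [hX]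
  exact ENNReal.ofReal_le_ofReal hreal

end Summit.AtomisticToContinuum.BoseEinsteinCondensation.Theorems.CutLineWitness

end
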